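import Summits.QuantumFields.BalabanUV.Beta.CovariantBoxPoincare

/-!
# Beta / MultiscaleCoercive — THE k-UNIFORM MULTISCALE LOCAL COERCIVITY OF THE MULTI-REGION AVERAGED OPERATOR (MODEL):
# for pv21's `levelOp = Δ_U + Σ_j a_j·G_jᵀG_j` ([B9] (3.24) SHAPE: level-`j` averaging on its own region) and ANY family of
# pairwise distinct charted cells (level `l_k`, block `β_k`, side `n_k`, tree-gauge defect `h_k`),
# `Σ_k t_k(1 − 4P_kνh_k²)·‖f‖²_{cell k} ≤ ⟨f, levelOp f⟩` for budgets `t_k·4P_k/c² ≤ 1`, `t_k·2/n_k^ν ≤ a_{l_k}w_k²`, hence in print's normalisation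
# `(1 − θ)·min(c²/(4ν), a/2)·Σ_k n_k⁻²·‖f‖²_{cell k} ≤ ⟨f, levelOp f⟩` — a constant depending on `ν`, `c`, `a` ONLY: no level
# count, no volume, no `2^{−k}` recursion (unit `b2b-balaban-beta-d4-p2`, GEN 7, MODEL crew; claim «MULTISCALE-POINCARE-MODEL»
# journal l.16779; part (C) of three, over (A) `BoxPoincare` p225669 and (B) `CovariantBoxPoincare`)

HONEST FRAMING: discharging `BetaPertH` makes Bałaban's UV stability UNCONDITIONAL — NOT the continuum limit, NOT the
Clay problem.  HONEST DEPENDENCY (verbatim): «continuum YM on T⁴ ⇐ BetaPertH ∧ nine spine estimates (0/9 proved);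
BetaPertH ⇐ (D1) ∧ (D4) ∧ CAP+tail; G-an2-4 gates asym, D1 and NE2/3/4.»  THIS MODULE DISCHARGES NOTHING of `BetaPertH`,
asserts NOTHING printed and cites nothing as a fact (ABSOLUTE RULE): [folklore] bookkeeping about the pv21 component MODEL
(`B9Thm37GlueTorusCovLevels.levelOp` with GENERAL data `blk, W, T, a`; cells, charts, transports, defects as DATA).  WHAT IT
IS FOR (row D4, NODE O.2 item (v) «k-UNIFORM constants», skeleton `beta/skeletons/D4-NODE-O2-b2b-balaban-beta-d4-p2.md` §2):
[B9] = `Balaban1985BackgroundPropagators` Thm 3.1 p. 397 carries the LOCAL prefactor `(L^jη)²` on `Λ_j` with «constants depending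
on d and L only»; pv21's `coercive_levelOp`∕`coercive_towerOp` give ONE global `σ_k ≲ 2^{−k}/ΠN_j` (honest scope (ii)); this file
is the lower-bound half in print's LOCAL, LEVEL-COUNT-FREE shape.  NOT modelled: print's region geometry ([B6] (2.1)–(2.2)), the
DECAY half of Thm 3.1 (rate `δ₀` in `d(y,y′)` via scale-adapted partitions of unity — successor node), Bałaban's own `U_k`,
`Ū^l`.  No class change on row D4 (critical-path width 0; D4 DISCHARGE NO DATE); NOT BetaPertH, NOT continuum, NOT Clay, NOT
summit progress.

CONTENT (kernel, 0 sorry).  §1 a charted cell's averaging term: `G_l f(β, a) = w·Σ_v (T f)(φ v)_a` (`gMean_cell`).  §2 the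
CELL BOUND `cell_bound`: `t·(1 − 4Pνh²)·‖f‖²_cell ≤ E_cell + a_l·Σ_a G_l f(β,a)²` for every budget `t ≥ 0` with `t·4P/c² ≤ 1`,
`t·2/n^ν ≤ a_l w²` (part (B)).
§3 END **`multiscale_coercive`** (sum over pairwise distinct cells with pairwise distinct in-box bonds, against `qform_levelOp`;
budgets `t_k` as data) and **`multiscale_coercive_scaled`** (print's normalisation: `a_l w² n^ν ≥ a_min/n²`, loss `4Pνh² ≤ θ` ⟹
constant `(1 − θ)·min(c²/(4ν), a_min/2)/n_k²`; `θ = 0` is the flat case `U = 1`).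
-/

namespace Summit.QuantumFields.BalabanUV.Beta.MultiscaleCoercive

open Finset Function
open Summit.QuantumFields.BalabanUV.Beta.BoxPoincare
open Summit.QuantumFields.BalabanUV.Beta.CovariantBoxPoincare
open Literature.MathematicalPhysics.QuantumFieldTheory.Balaban1983to89.B9Thm37Glue (covD covD_apply)
open Literature.MathematicalPhysics.QuantumFieldTheory.Balaban1983to89.B9Thm37GlueTorusCovComp (gMean gMean_apply)
open Literature.MathematicalPhysics.QuantumFieldTheory.Balaban1983to89.B9Thm37GlueTorusCovLevels (levelOp qform_levelOp)
open Literature.MathematicalPhysics.QuantumFieldTheory.Balaban1983to89.B9Thm37GlueTorusCovLevelsPoinc (sum_sq_orth_apply)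

noncomputable section

variable {St Bd B Cp J K : Type} [Fintype St] [DecidableEq St] [DecidableEq B] [Fintype Cp] {ν : ℕ}

/-! ## §1 A charted cell's averaging term -/

section Cell

variable {n : ℕ} (blk : St → B) (W : St → ℝ) (T : St → Cp → Cp → ℝ) (φ : Box ν n → St) (β : B) {wt : ℝ}

/-- The block of a charted cell is the image of the chart. [folklore] -/
theorem filter_blk_eq_image (hφblk : ∀ x, blk x = β ↔ ∃ v, φ v = x) :
    (Finset.univ.filter fun x => blk x = β) = Finset.univ.image φ := by
  ext x
  simp only [Finset.mem_filter, Finset.mem_univ, true_and, Finset.mem_image]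
  exact hφblk x

/-- **A charted cell's averaging term**: `G f(β, a) = w·Σ_v (T(φ v) f(φ v))_a` — the covariant block sum of the cell in the
currency of part (B) (`tf`). [cite: Balaban1985BackgroundPropagators, (3.19) p.393] -/
theorem gMean_cell (hφinj : Injective φ) (hφblk : ∀ x, blk x = β ↔ ∃ v, φ v = x) (hW : ∀ v, W (φ v) = wt)
    (f : St × Cp → ℝ) (a : Cp) :
    gMean blk W T f (β, a) = wt * ∑ v : Box ν n, tf (fun v => T (φ v)) φ f v a := by
  rw [gMean_apply, ← Finset.sum_filter, filter_blk_eq_image blk φ β hφblk, Finset.sum_image fun v _ w _ h => hφinj h,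
    Finset.mul_sum]
  refine Finset.sum_congr rfl fun v _ => ?_
  rw [hW v]
  rfl

/-- The cell mass in the two currencies: `Σ_v Σ_k f(φ v, k)²` is the mass of `f` on the block. [folklore] -/
theorem sum_sq_cell (hφinj : Injective φ) (hφblk : ∀ x, blk x = β ↔ ∃ v, φ v = x) (f : St × Cp → ℝ) :
    ∑ v : Box ν n, ∑ k, f (φ v, k) ^ 2 = ∑ x ∈ Finset.univ.filter (fun x => blk x = β), ∑ k, f (x, k) ^ 2 := by
  rw [filter_blk_eq_image blk φ β hφblk, Finset.sum_image fun v _ w _ h => hφinj h]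

end Cell

/-! ## §2 The cell bound -/

section CellBound

variable [DecidableEq Cp] {src tgt : Bd → St} {n : ℕ}

/-- **THE CELL BOUND.**  A charted cell (chart `φ` onto the block `β` of the blocking `blk`, constant weight `w` on it, in-box
bonds `e` with `|c| ≥ c_min`, orthogonal transports `T` on the block with tree-gauge defect `h`, coefficient `a_l ≥ 0`) and a
budget `t ≥ 0` with `t·4P/c_min² ≤ 1` and `t·2/n^ν ≤ a_l w²` (`P = νn(n−1)`; e.g. `t = min(c_min²/(4P), a_l w² n^ν/2)` for
`n ≥ 2`): `t·(1 − 4Pνh²)·Σ_v|f(φ v)|² ≤ Σ_{in-box bonds}|(∇_U f)(e)|² + a_l·Σ_a G f(β,a)²` — the cell's mass is paid by ITS OWN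
energy and ITS OWN averaging term. [cite: Balaban1985BackgroundPropagators, (3.24) p.394 + Thm 3.1 p.397] -/
theorem cell_bound (blk : St → B) (W : St → ℝ) (T : St → Cp → Cp → ℝ) {al : ℝ}
    (φ : Box ν n → St) (β : B) {wt : ℝ} (hφinj : Injective φ) (hφblk : ∀ x, blk x = β ↔ ∃ v, φ v = x)
    (hW : ∀ v, W (φ v) = wt) (e : (v : Box ν n) → (i : Fin ν) → ((v i : ℕ) + 1 < n) → Bd)
    (hsrc : ∀ v i hv, src (e v i hv) = φ v) (htgt : ∀ v i hv, tgt (e v i hv) = φ (succ v i hv))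
    (c : Bd → ℝ) {cmin : ℝ} (hcmin : 0 < cmin) (hcb : ∀ v i hv, cmin ≤ |c (e v i hv)|)
    (Rm : Bd → Cp → Cp → ℝ) (hT : ∀ v i i', ∑ k, T (φ v) k i * T (φ v) k i' = if i = i' then (1 : ℝ) else 0) {h : ℝ}
    (hHol : ∀ v i hv (u : Cp → ℝ),
      ∑ a, (∑ j, (hol Rm (fun v => T (φ v)) e v i hv a j - if a = j then 1 else 0) * u j) ^ 2 ≤ h ^ 2 * ∑ j, u j ^ 2)
    {t : ℝ} (ht0 : 0 ≤ t) (ht1 : t * (4 * ((ν : ℝ) * n * ((n : ℝ) - 1)) / cmin ^ 2) ≤ 1)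
    (ht2 : t * (2 / (n : ℝ) ^ ν) ≤ al * wt ^ 2) (f : St × Cp → ℝ) :
    t * (1 - 4 * ((ν : ℝ) * n * ((n : ℝ) - 1)) * ν * h ^ 2) * ∑ v : Box ν n, ∑ k, f (φ v, k) ^ 2 ≤
      ∑ v : Box ν n, ∑ i : Fin ν,
          (if hv : (v i : ℕ) + 1 < n then ∑ k, covD src tgt c Rm f (e v i hv, k) ^ 2 else 0) +
        al * ∑ a, gMean blk W T f (β, a) ^ 2 := by
  set P : ℝ := (ν : ℝ) * n * ((n : ℝ) - 1) with hP
  set Sf : ℝ := ∑ v : Box ν n, ∑ k, f (φ v, k) ^ 2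
  set E : ℝ := ∑ v : Box ν n, ∑ i : Fin ν,
    (if hv : (v i : ℕ) + 1 < n then ∑ k, covD src tgt c Rm f (e v i hv, k) ^ 2 else 0) with hE
  set M : ℝ := ∑ a, (∑ v : Box ν n, tf (fun v => T (φ v)) φ f v a) ^ 2 with hM
  have hEnn : 0 ≤ E :=
    sum_nonneg fun v _ => sum_nonneg fun i _ => by split_ifs <;> [exact sum_nonneg fun _ _ => sq_nonneg _; exact le_rfl]
  have hMnn : 0 ≤ M := sum_nonneg fun _ _ => sq_nonneg _
  -- part (B)
  have hB := covariant_box_poincare φ e hsrc htgt c hcmin hcb Rm (fun v => T (φ v)) hT hHol f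
  -- the averaging term of the cell
  have hG : ∑ a, gMean blk W T f (β, a) ^ 2 = wt ^ 2 * M := by
    rw [hM, Finset.mul_sum]
    refine Finset.sum_congr rfl fun a _ => ?_
    rw [gMean_cell blk W T φ β hφinj hφblk hW f a, mul_pow]
  rw [hG]
  have hB' : t * ((1 - 4 * P * ν * h ^ 2) * Sf) ≤ t * (4 * P / cmin ^ 2 * E + 2 / (n : ℝ) ^ ν * M) :=
    mul_le_mul_of_nonneg_left hB ht0
  calc t * (1 - 4 * P * ν * h ^ 2) * Sf = t * ((1 - 4 * P * ν * h ^ 2) * Sf) := by ring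
    _ ≤ t * (4 * P / cmin ^ 2 * E + 2 / (n : ℝ) ^ ν * M) := hB'
    _ = (t * (4 * P / cmin ^ 2)) * E + (t * (2 / (n : ℝ) ^ ν)) * M := by ring
    _ ≤ 1 * E + (al * wt ^ 2) * M :=
        add_le_add (mul_le_mul_of_nonneg_right ht1 hEnn) (mul_le_mul_of_nonneg_right ht2 hMnn)
    _ = E + al * (wt ^ 2 * M) := by ring

end CellBound

/-! ## §3 The multiscale coercivity: sum over pairwise distinct cells -/

section Assembly

variable [Fintype Bd] [Fintype B] [DecidableEq Cp] [Fintype J] [Fintype K] (src tgt : Bd → St) (c : Bd → ℝ) (Rm : Bd → Cp → Cp → ℝ) (blk : J → St → B) (W : J → St → ℝ)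
  (T : J → St → Cp → Cp → ℝ) (a : J → ℝ)
  -- the cells: side, level, block, weight, tree-gauge defect, budget, chart, in-box bonds
  (n : K → ℕ) (lvl : K → J) (lab : K → B) (wt hd t : K → ℝ)
  (φ : (k : K) → Box ν (n k) → St)
  (e : (k : K) → (v : Box ν (n k)) → (i : Fin ν) → ((v i : ℕ) + 1 < n k) → Bd)

/-- **THE k-UNIFORM MULTISCALE LOCAL COERCIVITY (MODEL).**  For pv21's `levelOp = Δ_U + Σ_j a_j·G_jᵀG_j` with general data
(isometric level transports, `a ≥ 0`, `|c| ≥ c_min` on the cells' bonds) and ANY finite family of charted cells that are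
pairwise distinct as (level, block) pairs (`hcell`) with pairwise distinct in-box bonds (`hbond`), constant weights `w_k`,
tree-gauge defects `h_k` and budgets `t_k` (`t_k·4P_k/c_min² ≤ 1`, `t_k·2/n_k^ν ≤ a_{l_k}w_k²`):
`Σ_k t_k(1 − 4P_kνh_k²)·Σ_v|f(φ_k v)|² ≤ ⟨f, levelOp f⟩` — each cell paid by its own energy and its own averaging term, so NO
dependence on the number of levels or cells. [cite: Balaban1985BackgroundPropagators, (3.24) p.394 + Thm 3.1 p.397] -/
theorem multiscale_coercive
    (hT : ∀ j x i i', ∑ k, T j x k i * T j x k i' = if i = i' then (1 : ℝ) else 0) {cmin : ℝ} (hcmin : 0 < cmin)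
    (hφinj : ∀ k, Injective (φ k)) (hφblk : ∀ k x, blk (lvl k) x = lab k ↔ ∃ v, φ k v = x)
    (hW : ∀ k v, W (lvl k) (φ k v) = wt k)
    (hsrc : ∀ k v i hv, src (e k v i hv) = φ k v) (htgt : ∀ k v i hv, tgt (e k v i hv) = φ k (succ v i hv))
    (hcb : ∀ k v i hv, cmin ≤ |c (e k v i hv)|)
    (hHol : ∀ k v i hv (u : Cp → ℝ),
      ∑ a', (∑ j, (hol Rm (fun v => T (lvl k) (φ k v)) (e k) v i hv a' j - if a' = j then 1 else 0) * u j) ^ 2 ≤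
        hd k ^ 2 * ∑ j, u j ^ 2)
    (ht0 : ∀ k, 0 ≤ t k) (ht1 : ∀ k, t k * (4 * ((ν : ℝ) * (n k) * ((n k : ℝ) - 1)) / cmin ^ 2) ≤ 1)
    (ht2 : ∀ k, t k * (2 / (n k : ℝ) ^ ν) ≤ a (lvl k) * wt k ^ 2)
    (hbond : ∀ F : Bd → ℝ, (∀ b, 0 ≤ F b) →
      ∑ k, ∑ v : Box ν (n k), ∑ i : Fin ν, (if hv : (v i : ℕ) + 1 < n k then F (e k v i hv) else 0) ≤ ∑ b, F b)
    (hcell : ∀ A : J → B → ℝ, (∀ j β, 0 ≤ A j β) → ∑ k, a (lvl k) * A (lvl k) (lab k) ≤ ∑ j, a j * ∑ β, A j β)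
    (f : St × Cp → ℝ) :
    ∑ k, t k * (1 - 4 * ((ν : ℝ) * (n k) * ((n k : ℝ) - 1)) * ν * hd k ^ 2) * ∑ v : Box ν (n k), ∑ i, f (φ k v, i) ^ 2 ≤
      ∑ p, f p * levelOp src tgt c Rm blk W T a f p := by
  -- per cell
  have hk : ∀ k, t k * (1 - 4 * ((ν : ℝ) * (n k) * ((n k : ℝ) - 1)) * ν * hd k ^ 2) *
        ∑ v : Box ν (n k), ∑ i, f (φ k v, i) ^ 2 ≤
      ∑ v : Box ν (n k), ∑ i : Fin ν,
          (if hv : (v i : ℕ) + 1 < n k then ∑ i', covD src tgt c Rm f (e k v i hv, i') ^ 2 else 0) +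
        a (lvl k) * ∑ a', gMean (blk (lvl k)) (W (lvl k)) (T (lvl k)) f (lab k, a') ^ 2 := fun k =>
    cell_bound (blk (lvl k)) (W (lvl k)) (T (lvl k)) (φ k) (lab k) (hφinj k) (hφblk k) (hW k) (e k)
      (hsrc k) (htgt k) c hcmin (hcb k) Rm (fun v i i' => hT (lvl k) (φ k v) i i') (hHol k) (ht0 k) (ht1 k) (ht2 k) f
  -- sum and compare with the quadratic form
  have hEsum := hbond (fun b => ∑ i', covD src tgt c Rm f (b, i') ^ 2) fun b => sum_nonneg fun _ _ => sq_nonneg _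
  have hGsum := hcell (fun j β => ∑ a', gMean (blk j) (W j) (T j) f (β, a') ^ 2)
    fun j β => sum_nonneg fun _ _ => sq_nonneg _
  rw [qform_levelOp]
  calc ∑ k, t k * (1 - 4 * ((ν : ℝ) * (n k) * ((n k : ℝ) - 1)) * ν * hd k ^ 2) * ∑ v : Box ν (n k), ∑ i, f (φ k v, i) ^ 2
      ≤ ∑ k, (∑ v : Box ν (n k), ∑ i : Fin ν,
            (if hv : (v i : ℕ) + 1 < n k then ∑ i', covD src tgt c Rm f (e k v i hv, i') ^ 2 else 0) +
          a (lvl k) * ∑ a', gMean (blk (lvl k)) (W (lvl k)) (T (lvl k)) f (lab k, a') ^ 2) :=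
        Finset.sum_le_sum fun k _ => hk k
    _ ≤ ∑ b, ∑ i', covD src tgt c Rm f (b, i') ^ 2 + ∑ j, a j * ∑ β, ∑ a', gMean (blk j) (W j) (T j) f (β, a') ^ 2 := by
        rw [Finset.sum_add_distrib]
        exact add_le_add hEsum hGsum
    _ = ∑ b, covD src tgt c Rm f b * covD src tgt c Rm f b +
          ∑ j, a j * ∑ q, gMean (blk j) (W j) (T j) f q * gMean (blk j) (W j) (T j) f q := by
        congr 1
        · rw [Fintype.sum_prod_type]
          exact Finset.sum_congr rfl fun b _ => Finset.sum_congr rfl fun i _ => by ring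
        · refine Finset.sum_congr rfl fun j _ => ?_
          rw [Fintype.sum_prod_type]
          congr 1
          exact Finset.sum_congr rfl fun β _ => Finset.sum_congr rfl fun a' _ => by ring

/-- **PRINT'S NORMALISATION ⟹ A CONSTANT DEPENDING ON `ν, c, a` ONLY.**  If every cell has `1 ≤ n_k`, averaging weight of print
shape `a_{l_k} w_k² n_k^ν ≥ a_min/n_k²` ([B9] (3.24): `a_j (L^jη)^{d−2}·|L^{−jd}Σ|²` per block of side `L^j`), and tree-gauge loss
`4P_kνh_k² ≤ θ`, then with `κ = min(c_min²/(4ν), a_min/2)` — a function of `ν, c_min, a_min` ALONE —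
`(1 − θ)·κ·Σ_k n_k⁻²·Σ_v|f(φ_k v)|² ≤ ⟨f, levelOp f⟩`, uniformly in the number of levels and cells (`θ = 0` is the flat case
`U = 1`). [cite: Balaban1985BackgroundPropagators, (3.24) p.394 + Thm 3.1 p.397] -/
theorem multiscale_coercive_scaled
    (hT : ∀ j x i i', ∑ k, T j x k i * T j x k i' = if i = i' then (1 : ℝ) else 0) {cmin : ℝ} (hcmin : 0 < cmin)
    (hφinj : ∀ k, Injective (φ k)) (hφblk : ∀ k x, blk (lvl k) x = lab k ↔ ∃ v, φ k v = x)
    (hW : ∀ k v, W (lvl k) (φ k v) = wt k)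
    (hsrc : ∀ k v i hv, src (e k v i hv) = φ k v) (htgt : ∀ k v i hv, tgt (e k v i hv) = φ k (succ v i hv))
    (hcb : ∀ k v i hv, cmin ≤ |c (e k v i hv)|)
    (hHol : ∀ k v i hv (u : Cp → ℝ),
      ∑ a', (∑ j, (hol Rm (fun v => T (lvl k) (φ k v)) (e k) v i hv a' j - if a' = j then 1 else 0) * u j) ^ 2 ≤
        hd k ^ 2 * ∑ j, u j ^ 2)
    (hbond : ∀ F : Bd → ℝ, (∀ b, 0 ≤ F b) →
      ∑ k, ∑ v : Box ν (n k), ∑ i : Fin ν, (if hv : (v i : ℕ) + 1 < n k then F (e k v i hv) else 0) ≤ ∑ b, F b)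
    (hcell : ∀ A : J → B → ℝ, (∀ j β, 0 ≤ A j β) → ∑ k, a (lvl k) * A (lvl k) (lab k) ≤ ∑ j, a j * ∑ β, A j β)
    (hν : 1 ≤ ν) (hn : ∀ k, 1 ≤ n k) {amin : ℝ} (hamin : 0 ≤ amin)
    (hscale : ∀ k, amin / (n k : ℝ) ^ 2 ≤ a (lvl k) * wt k ^ 2 * (n k : ℝ) ^ ν) {θ : ℝ}
    (hloss : ∀ k, 4 * ((ν : ℝ) * (n k) * ((n k : ℝ) - 1)) * ν * hd k ^ 2 ≤ θ) (f : St × Cp → ℝ) :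
    (1 - θ) * min (cmin ^ 2 / (4 * ν)) (amin / 2) * ∑ k, ((n k : ℝ) ^ 2)⁻¹ * ∑ v : Box ν (n k), ∑ i, f (φ k v, i) ^ 2 ≤
      ∑ p, f p * levelOp src tgt c Rm blk W T a f p := by
  set κ : ℝ := min (cmin ^ 2 / (4 * ν)) (amin / 2) with hκ
  have hνr : (1 : ℝ) ≤ ν := by exact_mod_cast hν
  have hκnn : 0 ≤ κ := le_min (by positivity) (by positivity)
  -- the budgets `t_k = κ/n_k²`
  have ht0 : ∀ k, 0 ≤ κ * ((n k : ℝ) ^ 2)⁻¹ := fun k => mul_nonneg hκnn (inv_nonneg.mpr (sq_nonneg _))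
  have ht1 : ∀ k, κ * ((n k : ℝ) ^ 2)⁻¹ * (4 * ((ν : ℝ) * (n k) * ((n k : ℝ) - 1)) / cmin ^ 2) ≤ 1 := by
    intro k
    have hnk : (1 : ℝ) ≤ n k := by exact_mod_cast hn k
    have hc2 : 0 < cmin ^ 2 := by positivity
    calc κ * ((n k : ℝ) ^ 2)⁻¹ * (4 * ((ν : ℝ) * (n k) * ((n k : ℝ) - 1)) / cmin ^ 2)
        ≤ cmin ^ 2 / (4 * ν) * ((n k : ℝ) ^ 2)⁻¹ * (4 * ((ν : ℝ) * (n k) * ((n k : ℝ) - 1)) / cmin ^ 2) := by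
          have : 0 ≤ ((n k : ℝ) ^ 2)⁻¹ * (4 * ((ν : ℝ) * (n k) * ((n k : ℝ) - 1)) / cmin ^ 2) := by
            have : (0 : ℝ) ≤ (n k : ℝ) - 1 := by linarith
            positivity
          calc κ * ((n k : ℝ) ^ 2)⁻¹ * (4 * ((ν : ℝ) * (n k) * ((n k : ℝ) - 1)) / cmin ^ 2)
              = κ * (((n k : ℝ) ^ 2)⁻¹ * (4 * ((ν : ℝ) * (n k) * ((n k : ℝ) - 1)) / cmin ^ 2)) := by ring
            _ ≤ cmin ^ 2 / (4 * ν) * (((n k : ℝ) ^ 2)⁻¹ * (4 * ((ν : ℝ) * (n k) * ((n k : ℝ) - 1)) / cmin ^ 2)) :=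
                mul_le_mul_of_nonneg_right (min_le_left _ _) this
            _ = _ := by ring
      _ = ((n k : ℝ) - 1) / (n k) := by field_simp
      _ ≤ 1 := by rw [div_le_one (by positivity)]; linarith
  have ht2 : ∀ k, κ * ((n k : ℝ) ^ 2)⁻¹ * (2 / (n k : ℝ) ^ ν) ≤ a (lvl k) * wt k ^ 2 := by
    intro k
    have hnk : (1 : ℝ) ≤ n k := by exact_mod_cast hn k
    have hN : 0 < (n k : ℝ) ^ ν := by positivity
    have hs := hscale k
    rw [div_le_iff₀ (by positivity)] at hs
    calc κ * ((n k : ℝ) ^ 2)⁻¹ * (2 / (n k : ℝ) ^ ν) ≤ amin / 2 * ((n k : ℝ) ^ 2)⁻¹ * (2 / (n k : ℝ) ^ ν) := by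
          have : 0 ≤ ((n k : ℝ) ^ 2)⁻¹ * (2 / (n k : ℝ) ^ ν) := by positivity
          nlinarith [min_le_right (cmin ^ 2 / (4 * ν)) (amin / 2)]
      _ = amin / ((n k : ℝ) ^ 2 * (n k : ℝ) ^ ν) := by field_simp
      _ ≤ a (lvl k) * wt k ^ 2 := by
          rw [div_le_iff₀ (by positivity)]
          calc amin ≤ a (lvl k) * wt k ^ 2 * (n k : ℝ) ^ ν * (n k : ℝ) ^ 2 := hs
            _ = a (lvl k) * wt k ^ 2 * ((n k : ℝ) ^ 2 * (n k : ℝ) ^ ν) := by ring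
  have hmain := multiscale_coercive src tgt c Rm blk W T a n lvl lab wt hd (fun k => κ * ((n k : ℝ) ^ 2)⁻¹) φ e hT hcmin
    hφinj hφblk hW hsrc htgt hcb hHol ht0 ht1 ht2 hbond hcell f
  refine le_trans ?_ hmain
  rw [Finset.mul_sum]
  refine Finset.sum_le_sum fun k _ => ?_
  have hSnn : 0 ≤ ∑ v : Box ν (n k), ∑ i, f (φ k v, i) ^ 2 := sum_nonneg fun _ _ => sum_nonneg fun _ _ => sq_nonneg _
  calc (1 - θ) * κ * (((n k : ℝ) ^ 2)⁻¹ * ∑ v : Box ν (n k), ∑ i, f (φ k v, i) ^ 2)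
      = κ * ((n k : ℝ) ^ 2)⁻¹ * (1 - θ) * ∑ v : Box ν (n k), ∑ i, f (φ k v, i) ^ 2 := by ring
    _ ≤ κ * ((n k : ℝ) ^ 2)⁻¹ * (1 - 4 * ((ν : ℝ) * (n k) * ((n k : ℝ) - 1)) * ν * hd k ^ 2) *
          ∑ v : Box ν (n k), ∑ i, f (φ k v, i) ^ 2 := by
        refine mul_le_mul_of_nonneg_right ?_ hSnn
        exact mul_le_mul_of_nonneg_left (by linarith [hloss k]) (ht0 k)

end Assembly

end

end Summit.QuantumFields.BalabanUV.Beta.MultiscaleCoercive
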